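import Summits.CriticalPhenomena.PercolationContinuityZ3.Theorems.PercNearOneGluingNoHeavyLowerTailMajorityGluingTypeTableFixedMGrid
import HarnessLib

/-!
# The fixed-`M` programme in the kernel, template C (Σ₄-cells): the DATA side — rows and the check `checkFMC`
(lane prim-rate, constants-miner 1, gen 29; KERNEL-WINDOW.md §0 (4)–(5), §4 (3); CONVEX-BOOTSTRAP.md §5 «cells in (A, Σ₄)»)

Support file for the closed crux `NoHeavyLowerTail` (stmt-CriticalPhenomena-4575), majority-gluing line; continuation of
`…TypeTableFixedMGrid` (template B data: `BRow`, `checkFMB`).  Template C adds a CELL `t_lo ≤ Σ₄/4 ≤ t_hi` in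
`Σ₄ := Σ_z (S_z + T_z)` to the case and one new row kind, the ISO₄ CHORD ROW `N·U₄ − B·Σ₄ ≤ A`: by the ISO₄ row of `{1,2,3,4}`
and AM–GM, `U₄ ≤ M^{κ₀}·(Σ₄/4)^{4/c₄}`, and `t ↦ t^{4/c₄}` (`4/c₄ = 1.6277… ≥ 1`) is convex, hence below its chord on the cell;
with certified bounds `G ≥ t^{4/c₄}` at the cell ends and the grid bound `Cu4 k ≥ M^{κ₀}` the validity of a chord row is the
pure-`ℚ` check `CRow.ok`.  This file is computable data only (so that certificate files need nothing but it and `decide`);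
the soundness theorem `fixedMC_sound`, the certification of the cell constants and the cell cover are `…TypeTableFixedMCell`.
Definitions: `sig4φ`, `Cell`, `CELLS`, `Cu4`, `CRow`, `CRow.toRow`, `CRow.ok`, `checkFMC`.  No sorries.
[cite: VandenbergHaggstromKahn2005, Thm. 1.3 (p. 6)]
-/

namespace Summit.CriticalPhenomena.PercolationContinuityZ3.Theorems

namespace HubOnly
namespace TypeTable

open DType

/-! ### Data: the Σ₄ functional, cells, rows, the check -/

/-- `Σ₄ = Σ_z (1[S_z] + 1[T_z])` as an integer functional. -/
def sig4φ : DType → ℤ :=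
  combo [(1, fun τ => ind (τ.isS 1)), (1, fun τ => ind (τ.isT 1)), (1, fun τ => ind (τ.isS 2)), (1, fun τ => ind (τ.isT 2)),
    (1, fun τ => ind (τ.isS 3)), (1, fun τ => ind (τ.isT 3)), (1, fun τ => ind (τ.isS 4)), (1, fun τ => ind (τ.isT 4))]

/-- A Σ₄-cell `t_lo ≤ Σ₄/4 ≤ t_hi` with rational upper bounds `G_lo ≥ t_lo^{4/c₄}`, `G_hi ≥ t_hi^{4/c₄}`. -/
structure Cell where
  /-- lower end of `Σ₄/4` -/
  tlo : ℚ
  /-- upper end of `Σ₄/4` -/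
  thi : ℚ
  /-- certified bound of `t_lo^{4/c₄}` -/
  Glo : ℚ
  /-- certified bound of `t_hi^{4/c₄}` -/
  Ghi : ℚ

/-- The four cells of the lane (CONVEX-BOOTSTRAP §5: `Σ₄ ∈ [0,0.4], [0.4,0.8], [0.8,1.6], [1.6,8]`). -/
def CELLS : List Cell :=
  [⟨0, 1 / 10, 0, 235659 / 10 ^ 7⟩, ⟨1 / 10, 1 / 5, 235659 / 10 ^ 7, 72824 / 10 ^ 6⟩,
   ⟨1 / 5, 2 / 5, 72824 / 10 ^ 6, 225044 / 10 ^ 6⟩, ⟨2 / 5, 2, 225044 / 10 ^ 6, 309024 / 10 ^ 5⟩]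

/-- The grid bound of `M^{κ₀}` (`= (M^{4−c₄})^{1/c₄}`) for `M ≤ 2^{−k/32}`: `θ₄^{−4k}·η^{k}`. -/
def Cu4 (k : ℕ) : ℚ := powUp TH4L TH4U (-(4 * (k : ℤ))) * powUp ETAL ETAU k

/-- Rows of template C: a template-B row, the cell rows `Σ₄ ≥ 4t_lo`, `Σ₄ ≤ 4t_hi`, or a chord row `N·U₄ − B·Σ₄ ≤ A`. -/
inductive CRow where
  /-- a row of template B -/
  | b (r : BRow)
  /-- the cell's lower bound `−Σ₄ ≤ −4t_lo` -/
  | sigLo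
  /-- the cell's upper bound `Σ₄ ≤ 4t_hi` -/
  | sigHi
  /-- ISO₄ chord row `N·U₄ − B·Σ₄ ≤ A` -/
  | u4chord (N B : ℕ) (A : ℚ)

/-- The LP row of a template-C row in cell `c`. -/
def CRow.toRow (c : Cell) : CRow → Row
  | .b r => r.toRow
  | .sigLo => ⟨combo [(-1, sig4φ)], -(4 * c.tlo)⟩
  | .sigHi => ⟨sig4φ, 4 * c.thi⟩
  | .u4chord N B A => ⟨combo [((N : ℤ), fun τ => τ.uZ [1, 2, 3, 4]), (-(B : ℤ), sig4φ)], A⟩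

/-- Row validity in case `cs`, cell `c`, grid index `k`: template-B rows as before; the chord row needs `N > 0` and the chord
to dominate `Cu4 k · G` at both cell ends. -/
def CRow.ok (cs : FMCase) (c : Cell) (k : ℕ) : CRow → Bool
  | .b r => r.ok cs k
  | .sigLo => true
  | .sigHi => true
  | .u4chord N B A => decide (0 < N) && decide ((N : ℚ) * Cu4 k * c.Glo - 4 * B * c.tlo ≤ A) &&
      decide ((N : ℚ) * Cu4 k * c.Ghi - 4 * B * c.thi ≤ A)

/-- **The programme check of template C.** -/
def checkFMC (cs : FMCase) (c : Cell) (k : ℕ) (ks : List CRow) (y : List ℚ) (V : ℚ) : Bool :=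
  ks.all (CRow.ok cs c k) && decide (0 ≤ V) && checkCert eZ (ks.map (CRow.toRow c)) y V

/-- Smoke test of the data path: the chord row `10⁹·U₄ − 7792725·Σ₄ ≤ −3240000` in the cell `[1/5, 2/5]` at `k = 235` passes the check. -/
theorem crow_ok_smoke :
    CRow.ok ⟨[2, 1, 3, 4], fun _ => false⟩ ⟨1 / 5, 2 / 5, 72824 / 10 ^ 6, 225044 / 10 ^ 6⟩ 235
      (.u4chord (10 ^ 9) 7792725 (-3240000)) = true := by
  decide +kernel

end TypeTable
end HubOnly

end Summit.CriticalPhenomena.PercolationContinuityZ3.Theorems
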